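import Literature.RingTheory.FormalGroups.BudObstruction
import HarnessLib

/-!
# `p`-typical universality, the induction step: killing the obstruction in degree `n`
# ([Lazard 1955] §II proof of Thm. II; [Hazewinkel 1978] §15.2)

Topic `Literature/RingTheory/FormalGroups`; namespace `Literature.RingTheory.FormalGroups`.  One auxiliary DEFINITION
(`budDefect G H ψ = ψ(G(X,Y)) - H(ψX,ψY)`) + fully proved theorems; no named fact, no instance, no `sorry`.
Setting: `B` a commutative ring with `p` nilpotent, `G` a commutative law over `B`, `F_V = univTypicalLaw p` over `ℤ[V]`,
`φ : ℤ[V] → B` (given by `v : ℕ → B`) and a strict series `ψ` with `ψ(G) ≡ φ_*F_V(ψX,ψY) (mod deg n)`.  By Lazard's bud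
lemma the defect is `≡ c·C_n (mod deg n+1)`; it is killed

* `budStep_of_ne_pow` — if `n` is NOT a power of `p`: by the strict isomorphism `ψ' = ψ + t ψⁿ` with `t = -c/d_n`
  (`d_n` is prime to `p`, hence a unit since `p` is nilpotent) — `ψ'(G) ≡ H(ψ'X, ψ'Y) (mod deg n+1)`, `ψ' ≡ ψ (mod deg n)`;
* `budStep_of_pow` — if `n = p^{k+1}`: by moving the parameter, `v' = v` except `v'_k = v_k - c`, using the `V_k`-linear term
  of `F_V` (`UniversalTypicalLawLinear.lean`) — `ψ(G) ≡ φ'_*F_V(ψX,ψY) (mod deg n+1)`.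

Also: `budDefect_X` (the start `ψ = X`, `n = 1`), `formalGroup_map_isComm`, `natCast_cocycleGcd_smul_lazardPoly`
(`d_n C_n = (X+Y)ⁿ - Xⁿ - Yⁿ`).

## References
* [Lazard1955] M. Lazard, Bull. SMF 83 (1955), §II (proof of Théorème II), Prop. 2–3.
* [Hazewinkel1978] M. Hazewinkel, *Formal Groups and Applications* (1978), §15.2, §5.7.
-/

noncomputable section

namespace Literature.RingTheory.FormalGroups

open MvPowerSeries Finset Finsupp

universe u

variable {B : Type u} [CommRing B]

/-! ## §1 The defect of a strict series and generalities -/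

/-- The defect `ψ(G(X,Y)) - H(ψ(X), ψ(Y))` of a series `ψ` as a would-be homomorphism `G → H`. [cite: Lazard1955, §I (2.1)] -/
def budDefect (G H : FormalGroup B) (ψ : PowerSeries B) : MvPowerSeries (Fin 2) B :=
  PowerSeries.subst G.toPowerSeries ψ -
    H.toPowerSeries.subst ![PowerSeries.subst (X 0 : MvPowerSeries (Fin 2) B) ψ, PowerSeries.subst (X 1) ψ]

/-- Unfolding `budDefect`. [cite: Lazard1955, §I (2.1)] -/
theorem budDefect_def (G H : FormalGroup B) (ψ : PowerSeries B) : budDefect G H ψ =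
    PowerSeries.subst G.toPowerSeries ψ -
      H.toPowerSeries.subst ![PowerSeries.subst (X 0 : MvPowerSeries (Fin 2) B) ψ, PowerSeries.subst (X 1) ψ] := rfl

/-- The start of the induction: for `ψ = X` the defect is `G - H ≡ 0 (mod deg 2)`. [cite: Lazard1955, §II] -/
theorem two_le_order_budDefect_X (G H : FormalGroup B) : ((2 : ℕ) : ℕ∞) ≤ (budDefect G H PowerSeries.X).order := by
  have hX : (![PowerSeries.subst (X 0 : MvPowerSeries (Fin 2) B) (PowerSeries.X : PowerSeries B),
      PowerSeries.subst (X 1 : MvPowerSeries (Fin 2) B) (PowerSeries.X : PowerSeries B)] :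
      Fin 2 → MvPowerSeries (Fin 2) B) = (X : Fin 2 → MvPowerSeries (Fin 2) B) := by
    funext i; fin_cases i <;> simp [PowerSeries.subst_X (PowerSeries.HasSubst.X _)]
  rw [budDefect_def, PowerSeries.subst_X (hasSubst_formalGroup G), hX, subst_self]
  have hG := formalGroup_two_le_order_sub_X_sub_X G
  have hH := formalGroup_two_le_order_sub_X_sub_X H
  have e : G.toPowerSeries - (id H.toPowerSeries : MvPowerSeries (Fin 2) B) =
      (G.toPowerSeries - X 0 - X 1) - (H.toPowerSeries - X 0 - X 1) := by simp only [id]; ring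
  rw [e]
  exact natCast_le_order_sub hG hH

/-- Base change preserves commutativity. [cite: Hazewinkel1978, §1.1 (1.1.6)] -/
theorem formalGroup_map_isComm {S : Type*} [CommRing S] (F : FormalGroup B) [hF : F.IsComm] (f : B →+* S) :
    (F.map f).IsComm := by
  refine ⟨?_⟩
  change MvPowerSeries.map f F.toPowerSeries = (MvPowerSeries.map f F.toPowerSeries).subst ![X 1, X 0]
  have hv : (fun i => MvPowerSeries.map f ((![X 1, X 0] : Fin 2 → MvPowerSeries (Fin 2) B) i)) =
      (![X 1, X 0] : Fin 2 → MvPowerSeries (Fin 2) S) := by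
    funext i; fin_cases i <;> simp
  rw [← hv, ← map_subst HasSubst.X_X]
  exact congrArg _ hF.comm

/-- An integer prime to `p` is a unit in a ring in which `p` is nilpotent. [folklore] -/
private theorem exists_natCast_mul_eq_one {p m : ℕ} (hpB : IsNilpotent (p : B)) (hm : Nat.Coprime m p) :
    ∃ u : B, (m : B) * u = 1 := by
  obtain ⟨N, hN⟩ := hpB
  obtain ⟨a, b, hab⟩ := (Nat.isCoprime_iff_coprime.mpr (hm.pow_right N) : IsCoprime (m : ℤ) ((p : ℤ) ^ N))
  refine ⟨(a : B), ?_⟩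
  have h := congrArg (fun z : ℤ => (z : B)) hab
  simp only [Int.cast_add, Int.cast_mul, Int.cast_pow, Int.cast_natCast, Nat.cast_pow, Int.cast_one, hN, mul_zero,
    add_zero] at h
  rw [mul_comm]; exact h

/-- **`d_n · C_n = (X₀+X₁)ⁿ - X₀ⁿ - X₁ⁿ`** (`n ≥ 2`). [cite: Lazard1955, §I (définition de `B_q`, `C_q`)] -/
theorem natCast_cocycleGcd_smul_lazardPoly {n : ℕ} (hn : 2 ≤ n) :
    (cocycleGcd n : B) • lazardPoly B n = (X 0 + X 1) ^ n - X 0 ^ n - X 1 ^ n := by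
  rw [lazardPoly, Finset.smul_sum, add_pow]
  have hsplit : Finset.range (n + 1) = insert 0 (insert n (Finset.Ioo 0 n)) := by
    ext s; simp [Finset.mem_Ioo]; omega
  rw [hsplit, Finset.sum_insert (by simp; omega), Finset.sum_insert (by simp)]
  simp only [pow_zero, Nat.sub_zero, one_mul, Nat.choose_zero_right, Nat.cast_one, mul_one, Nat.sub_self, pow_zero,
    Nat.choose_self]
  have e1 : X 1 ^ n + (X 0 ^ n + ∑ s ∈ Finset.Ioo 0 n,
      X 0 ^ s * X 1 ^ (n - s) * ((n.choose s : ℕ) : MvPowerSeries (Fin 2) B)) - X 0 ^ n - X 1 ^ n =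
      ∑ s ∈ Finset.Ioo 0 n, X 0 ^ s * X 1 ^ (n - s) * ((n.choose s : ℕ) : MvPowerSeries (Fin 2) B) := by
    ring
  rw [e1]
  refine Finset.sum_congr rfl fun s hs => ?_
  rw [Finset.mem_Ioo] at hs
  rw [smul_smul, ← Nat.cast_mul, mul_comm (cocycleGcd n), lazardCoeff_mul_cocycleGcd (by omega) (by omega),
    Nat.cast_smul_eq_nsmul, nsmul_eq_mul, mul_comm]

/-! ## §2 Step A: `n` not a power of `p` — modify the strict series -/

/-- **Induction step when `n` is not a power of `p`.**  If `ψ` is strict with `ψ(G) ≡ H(ψX,ψY) (mod deg n)`, `n ≥ 2`,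
`n ≠ p^{v_p(n)}`, `G`, `H` commutative and `p` nilpotent in `B`, then some strict `ψ' ≡ ψ (mod deg n)` has
`ψ'(G) ≡ H(ψ'X,ψ'Y) (mod deg n+1)` — namely `ψ' = ψ + tψⁿ`, `t = -c/d_n`. [cite: Lazard1955, §II Prop. 3] -/
theorem budStep_of_ne_pow (p : ℕ) [Fact p.Prime] (hpB : IsNilpotent (p : B)) (G H : FormalGroup B) [G.IsComm] [H.IsComm]
    {ψ : PowerSeries B} (hψ0 : PowerSeries.constantCoeff ψ = 0) (hψ1 : PowerSeries.coeff 1 ψ = 1) {n : ℕ} (hn : 2 ≤ n)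
    (hnp : n ≠ p ^ n.factorization p) (hΔ : (n : ℕ∞) ≤ (budDefect G H ψ).order) :
    ∃ ψ' : PowerSeries B, PowerSeries.constantCoeff ψ' = 0 ∧ PowerSeries.coeff 1 ψ' = 1 ∧
      (∀ i < n, PowerSeries.coeff i ψ' = PowerSeries.coeff i ψ) ∧ ((n + 1 : ℕ) : ℕ∞) ≤ (budDefect G H ψ').order := by
  obtain ⟨c, hc⟩ := exists_le_order_bud_sub_lazardPoly G H hψ0 (budDefect_def G H ψ) p hpB hn hΔ
  obtain ⟨u, hu⟩ := exists_natCast_mul_eq_one hpB (coprime_cocycleGcd (p := p) hn hnp)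
  set t : B := -(c * u) with ht
  set ψ' : PowerSeries B := ψ + PowerSeries.C t * ψ ^ n with hψ'
  have hψn : ∀ m < n, PowerSeries.coeff m (ψ ^ n) = 0 :=
    PowerSeries.X_pow_dvd_iff.mp (pow_dvd_pow_of_dvd (PowerSeries.X_dvd_iff.mpr hψ0) n)
  have hlow : ∀ i < n, PowerSeries.coeff i ψ' = PowerSeries.coeff i ψ := by
    intro i hi
    rw [hψ', map_add, PowerSeries.coeff_C_mul, hψn i hi, mul_zero, add_zero]
  have hψ'0 : PowerSeries.constantCoeff ψ' = 0 := by
    rw [← PowerSeries.coeff_zero_eq_constantCoeff_apply, hlow 0 (by omega), PowerSeries.coeff_zero_eq_constantCoeff_apply, hψ0]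
  have hψ'1 : PowerSeries.coeff 1 ψ' = 1 := by rw [hlow 1 (by omega), hψ1]
  refine ⟨ψ', hψ'0, hψ'1, hlow, ?_⟩
  -- substitution formula for `ψ'`
  have hsub : ∀ {τ : Type} (Q : MvPowerSeries τ B), constantCoeff Q = 0 →
      PowerSeries.subst Q ψ' = PowerSeries.subst Q ψ + C t * (PowerSeries.subst Q ψ) ^ n := by
    intro τ Q hQ
    have hQs := PowerSeries.HasSubst.of_constantCoeff_zero hQ
    rw [hψ', PowerSeries.subst_add hQs, PowerSeries.subst_mul hQs, PowerSeries.subst_pow hQs, PowerSeries.subst_C]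
  have hψQ : ∀ {τ : Type} (Q : MvPowerSeries τ B), constantCoeff Q = 0 → constantCoeff (PowerSeries.subst Q ψ) = 0 :=
    fun Q hQ => PowerSeries.constantCoeff_subst_eq_zero hQ ψ hψ0
  -- the pieces
  set L := PowerSeries.subst G.toPowerSeries ψ with hL
  set P0 := PowerSeries.subst (X 0 : MvPowerSeries (Fin 2) B) ψ with hP0
  set P1 := PowerSeries.subst (X 1 : MvPowerSeries (Fin 2) B) ψ with hP1
  have hL0 : constantCoeff L = 0 := hψQ _ G.zero_constantCoeff
  have hP00 : constantCoeff P0 = 0 := hψQ _ (constantCoeff_X 0)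
  have hP10 : constantCoeff P1 = 0 := hψQ _ (constantCoeff_X 1)
  set Cn := lazardPoly B n with hCn
  -- (1) first-order expansion of `H`
  have s1 := formalGroup_le_order_subst_sub_subst_sub H (N := n) (by omega)
    (a := ![P0 + C t * P0 ^ n, P1 + C t * P1 ^ n]) (b := ![P0, P1])
    (fun i => by fin_cases i <;> simp [hP00, hP10, zero_pow (by omega : n ≠ 0)])
    (fun i => by fin_cases i <;> simp [hP00, hP10])
    (fun i => by
      fin_cases i
      · simpa using natCast_le_order_mul_left (C t) (natCast_le_order_pow hP00 n)
      · simpa using natCast_le_order_mul_left (C t) (natCast_le_order_pow hP10 n))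
  simp only [Matrix.cons_val_zero, Matrix.cons_val_one, add_sub_cancel_left] at s1
  -- (2) `ψ(G)ⁿ ≡ (X₀+X₁)ⁿ`, `ψ(Xᵢ)ⁿ ≡ Xᵢⁿ`
  have hmod2 : ∀ {Q : MvPowerSeries (Fin 2) B}, constantCoeff Q = 0 →
      ((2 : ℕ) : ℕ∞) ≤ (PowerSeries.subst Q ψ - Q).order := by
    intro Q hQ
    have h := le_order_psubst_sub_psubst_sub hψ0 hψ1 le_rfl hQ constantCoeff_zero
      (by simpa using one_le_order_of_constantCoeff hQ)
    rwa [PowerSeries.subst_zero_of_constantCoeff_zero hψ0, sub_zero, sub_zero] at h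
  have hL2 : ((2 : ℕ) : ℕ∞) ≤ (L - (X 0 + X 1)).order := by
    refine natCast_le_order_sub_trans (hmod2 G.zero_constantCoeff) ?_
    have h := formalGroup_two_le_order_sub_X_sub_X G
    rwa [sub_sub] at h
  have s2 := le_order_pow_sub_pow hL0 (by simp) hL2 n (by omega)
  have s30 := le_order_pow_sub_pow hP00 (constantCoeff_X 0) (hmod2 (constantCoeff_X 0)) n (by omega)
  have s31 := le_order_pow_sub_pow hP10 (constantCoeff_X 1) (hmod2 (constantCoeff_X 1)) n (by omega)
  rw [show 2 + n - 1 = n + 1 by omega] at s2 s30 s31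
  -- (3) the identity
  have hd : ((X 0 + X 1) ^ n - X 0 ^ n - X 1 ^ n : MvPowerSeries (Fin 2) B) = C (cocycleGcd n : B) * Cn := by
    rw [hCn, ← natCast_cocycleGcd_smul_lazardPoly hn, smul_eq_C_mul]
  have hct : (C c + C t * C (cocycleGcd n : B) : MvPowerSeries (Fin 2) B) = 0 := by
    rw [← map_mul, ← map_add, ht, show c + -(c * u) * (cocycleGcd n : B) = c * (1 - (cocycleGcd n : B) * u) by ring, hu,
      sub_self, mul_zero, map_zero]
  have e : budDefect G H ψ' =
      (budDefect G H ψ - C c * Cn) + C t * ((L ^ n - (X 0 + X 1) ^ n) - (P0 ^ n - X 0 ^ n) - (P1 ^ n - X 1 ^ n))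
        - (H.toPowerSeries.subst ![P0 + C t * P0 ^ n, P1 + C t * P1 ^ n] - H.toPowerSeries.subst ![P0, P1]
            - (C t * P0 ^ n + C t * P1 ^ n)) := by
    rw [budDefect_def, budDefect_def, hsub _ G.zero_constantCoeff, hsub _ (constantCoeff_X 0), hsub _ (constantCoeff_X 1),
      ← hL, ← hP0, ← hP1]
    linear_combination (C t) * hd + Cn * hct
  rw [e]
  exact natCast_le_order_sub (natCast_le_order_add hc (natCast_le_order_mul_left _
    (natCast_le_order_sub (natCast_le_order_sub s2 s30) s31))) s1

/-! ## §3 Step B: `n = p^{k+1}` — move the parameter `V_{k+1} = X k` -/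

/-- **Induction step when `n = p^{k+1}`.**  If `ψ` is strict with `ψ(G) ≡ φ_*F_V(ψX,ψY) (mod deg p^{k+1})` (`φ` given by
`v : ℕ → B`), `G` commutative and `p` nilpotent in `B`, then for `v' = v` except `v'_k = v_k + t` (some `t`) one has
`ψ(G) ≡ φ'_*F_V(ψX,ψY) (mod deg p^{k+1}+1)`. [cite: Hazewinkel1978, §15.2] -/
theorem budStep_of_pow (p : ℕ) [Fact p.Prime] (hpB : IsNilpotent (p : B)) (G : FormalGroup B) [G.IsComm]
    (v : ℕ → B) {ψ : PowerSeries B} (hψ0 : PowerSeries.constantCoeff ψ = 0) (hψ1 : PowerSeries.coeff 1 ψ = 1) (k : ℕ)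
    (hΔ : ((p ^ (k + 1) : ℕ) : ℕ∞) ≤
      (budDefect G ((univTypicalLaw p).map (MvPolynomial.eval₂Hom (Int.castRingHom B) v)) ψ).order) :
    ∃ t : B, ((p ^ (k + 1) + 1 : ℕ) : ℕ∞) ≤
      (budDefect G ((univTypicalLaw p).map (MvPolynomial.eval₂Hom (Int.castRingHom B) (Function.update v k (v k + t)))) ψ).order := by
  set n := p ^ (k + 1) with hn
  have hn2 : 2 ≤ n := le_trans (Fact.out : p.Prime).two_le (by rw [hn]; exact Nat.le_self_pow (by omega) p)
  haveI := univTypicalLaw_isComm p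
  haveI := formalGroup_map_isComm (univTypicalLaw p) (MvPolynomial.eval₂Hom (Int.castRingHom B) v)
  obtain ⟨c, hc⟩ := exists_le_order_bud_sub_lazardPoly G _ hψ0 (budDefect_def G _ ψ) p hpB hn2 hΔ
  refine ⟨-c, ?_⟩
  set φ := MvPolynomial.eval₂Hom (Int.castRingHom B) v with hφ
  set φ' := MvPolynomial.eval₂Hom (Int.castRingHom B) (Function.update v k (v k + -c)) with hφ'
  have hX : ∀ j, j ≠ k → φ' (MvPolynomial.X j) = φ (MvPolynomial.X j) := by
    intro j hj; rw [hφ', hφ, MvPolynomial.eval₂Hom_X', MvPolynomial.eval₂Hom_X', Function.update_of_ne hj]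
  have hk : φ' (MvPolynomial.X k) = φ (MvPolynomial.X k) + -c := by
    rw [hφ', hφ, MvPolynomial.eval₂Hom_X', MvPolynomial.eval₂Hom_X', Function.update_self]
  have hlin := le_order_map_sub_map_add_univTypicalLaw p k (-c) hX hk
  rw [← hn] at hlin
  set Hs := ((univTypicalLaw p).map φ).toPowerSeries with hHs
  set Hs' := ((univTypicalLaw p).map φ').toPowerSeries with hHs'
  set Cn := lazardPoly B n with hCn
  set P0 := PowerSeries.subst (X 0 : MvPowerSeries (Fin 2) B) ψ with hP0
  set P1 := PowerSeries.subst (X 1 : MvPowerSeries (Fin 2) B) ψ with hP1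
  have hP00 : constantCoeff P0 = 0 := PowerSeries.constantCoeff_subst_eq_zero (constantCoeff_X 0) ψ hψ0
  have hP10 : constantCoeff P1 = 0 := PowerSeries.constantCoeff_subst_eq_zero (constantCoeff_X 1) ψ hψ0
  have hb : ∀ i, constantCoeff ((![P0, P1] : Fin 2 → MvPowerSeries (Fin 2) B) i) = 0 := by
    intro i; fin_cases i <;> simp [hP00, hP10]
  have hbs : HasSubst (![P0, P1] : Fin 2 → MvPowerSeries (Fin 2) B) := hasSubst_of_constantCoeff_zero hb
  -- (4) `(Hs' - (Hs + c Cn))(ψX₀,ψX₁) ≡ 0`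
  have s4 := le_order_subst_of_le_order hlin hb
  rw [subst_sub hbs, subst_sub hbs, subst_mul hbs, subst_C] at s4
  -- (5) `Cn(ψX₀,ψX₁) ≡ Cn`
  have hmod2 : ∀ {Q : MvPowerSeries (Fin 2) B}, constantCoeff Q = 0 →
      ((2 : ℕ) : ℕ∞) ≤ (PowerSeries.subst Q ψ - Q).order := by
    intro Q hQ
    have h := le_order_psubst_sub_psubst_sub hψ0 hψ1 le_rfl hQ constantCoeff_zero
      (by simpa using one_le_order_of_constantCoeff hQ)
    rwa [PowerSeries.subst_zero_of_constantCoeff_zero hψ0, sub_zero, sub_zero] at h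
  have s5 : ((n + 1 : ℕ) : ℕ∞) ≤ (subst ![P0, P1] Cn - Cn).order := by
    have h := le_order_subst_sub_subst (r := n) (N := 2) (by omega) (by norm_num) (le_order_lazardPoly (R := B) n) hb
      (b := (X : Fin 2 → MvPowerSeries (Fin 2) B)) (fun i => constantCoeff_X i)
      (fun i => by
        fin_cases i
        · simpa using hmod2 (constantCoeff_X 0)
        · simpa using hmod2 (constantCoeff_X 1))
    rwa [show 2 + n - 1 = n + 1 by omega, subst_self, ← hCn] at h
  have e : budDefect G ((univTypicalLaw p).map φ') ψ =
      (budDefect G ((univTypicalLaw p).map φ) ψ - C c * Cn) + C (-c) * (subst ![P0, P1] Cn - Cn)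
        - (subst ![P0, P1] Hs' - (subst ![P0, P1] Hs - C (-c) * subst ![P0, P1] Cn)) := by
    rw [budDefect_def, budDefect_def, ← hHs, ← hHs', ← hP0, ← hP1, map_neg]
    ring
  rw [e]
  exact natCast_le_order_sub (natCast_le_order_add hc (natCast_le_order_mul_left _ s5)) s4

end Literature.RingTheory.FormalGroups
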